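import Summits.CriticalPhenomena.PercolationContinuityZ3.Theorems.PercNearOneGluingNoHeavyLowerTailSahiCombZsumReading

/-!
# (HC) PROVED, part I: the kernel lemma of the half-chain Hall design — a 7-step human elimination

Support file of the one-cut programme (crux `NoHeavyLowerTail`, stmt-CriticalPhenomena-4575; cell `prim-masterthm`, seat P5 gen 29;
memo `FROM-prim-masterthm-p5-g29-HALFCHAIN-PROOF.md`).  Companion of `…SahiCombTriWHalfChainHall` (P5 gen 28: the netted token identity
`inner_pair_eq_halfChain`, the typed Hall statement `HalfChainHall` and its reduction to `TRI_W(2) ≥ 0` on the half-chain stratum) and of the reading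
toolkit `…SahiCombZsumReading` (prim-lf-1 gen 38).  Pattern: `…SahiCombTriWAntiNestedKernelProof` (AN♯3).

SETTING (the half-chain token system of P5 gen 28, design HC-0 of its machine proof).  Up-sets of a finite cube: an `F`-DIAMOND
`F₀ ⊆ Fp, Fq ⊆ F₁` and a `G`-CHAIN `G₀ ⊆ Gp ⊆ Gq ⊆ G₁`; supply levels `S = F₁G₁`, `U = F₀G₀`, `M = FpGp`, `N = FqGq` (two copies each);
ten coefficient vectors on the demand classes
`a = refl F₀ ∩ G₁`, `b = F₀ ∩ refl G₁`, `c = refl F₁ ∩ G₀`, `d = F₁ ∩ refl G₀`, `e = refl Fp ∩ Gq`, `f = Fp ∩ refl Gq`, `g = refl Fq ∩ Gp`,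
`h = Fq ∩ refl Gp`, `i = refl((Fq\Fp)(Gq\Gp))` (crossed shell), `j = refl Σ`, `Σ = (F₁\F₀)(G₁\G₀) \ (Fp\Fq)(Gq\Gp)` (netted outer shell);
eight level equations for the zeta combinations `Z x = zsum kx` (visibility design HC-0):
`E0 (S_a): Z a + Z d + Z f + Z g + Z h + Z j = 0` and `E1 (S_b): Z b + Z c + Z e + Z f + Z h = 0` on `S`; `E2 (U_a): Z d = 0`, `E3 (U_b): Z c = 0` on `U`;
`E4 (M_a): Z c + Z g = 0`, `E5 (M_b): Z e = 0` on `M`; `E6 (N_a): Z b + Z g = 0`, `E7 (N_b): Z c + Z f + Z i = 0` on `N`.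

* **`FiveUpSet.halfChain_kernel_eq_zero`** — all ten vectors vanish (kernel form at `P = ⊤`).  PROOF (7 human steps replacing the 486-line machine log
  `prim-masterthm-p5/code28/cprove/proof_HC_design0.log`; tools: point support, C2′ `eq_zero_of_zsum_eq_zero_on`, antipodal extension `zsum_ext`, diagonal
  readings `diag_read₂/₃`): (1) `g` by C2′ on `Fq ∩ Gp` (`E4`+`E3` inside `F₀`, `E6` outside); (2) `i` by ONE diagonal reading of `E1 − E7` on `N` (foreign
  coordinates on `refl Fp ∪ refl Gp`, disjoint from the crossed shell); (3) `Z e = 0` on `F₁Gp` (extension from `M`, `E5`), then `c` by C2′ on `F₁ ∩ G₀`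
  (cases `Fp` / `Fq \ Fp` / neither: `E4` / `E7` / `E1`); (4) `h` by C2′ (`E1` on `Fq ∩ Gp`); (5) `Z f = 0` on `FqG₁` (extension from `N`), then `b` by C2′
  (`E6` inside `Gq`, `E1` outside); (6) `j`: diagonal readings of `E0` and `E0 − E1` on `S` confine the complements of the `j`-indices to `Gq ∩ Fp`, hence (definition
  of `Σ`) to `Y* = F₁Gp ∪ FqG₁`, where `Z e = 0` and `E0 − E1 = Z j + Z a + Z d`: a third reading kills `j`; (7) `Z d = 0` on `F₀G₁` (extension from `U`), then
  `a`, `d`, `f`, `e` by C2′ from `E0 − E1`, `E0`, `E1`.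
* **`FiveUpSet.halfChain_kernel_eq_zero_of_upperSet`** — the same inside an arbitrary up-set `P` (the restriction is free, as for RANK-Z / AN♯1 / AN♯3);
  hypotheses literally in the shape of `halfChainDemand` / `halfChainSupply` of `…SahiCombTriWHalfChainHall`.
The counting corollary `halfChainHall_holds : HalfChainHall` and the unconditional half-chain stratum are in `…SahiCombTriWHalfChainHallProof`.
HONEST LABEL: complete proofs, std axioms; elementary linear algebra over `ℚ` (no census input). [this work]
-/

namespace Summit.CriticalPhenomena.PercolationContinuityZ3.Theorems

namespace FiveUpSet

open Finset

variable {α : Type} [DecidableEq α] [Fintype α]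

/-! ### The kernel lemma at `P = ⊤` -/

/-- **Half-chain Hall, kernel form at `P = ⊤` (design HC-0).**  For an `F`-diamond `F₀ ⊆ Fp, Fq ⊆ F₁` and a `G`-chain `G₀ ⊆ Gp ⊆ Gq ⊆ G₁` of up-sets
of the cube `Finset α` and coefficient vectors `ka … kj` supported on the ten half-chain demand classes, the eight level equations of design HC-0 force all
ten vectors to vanish. [this work] -/
theorem halfChain_kernel_eq_zero (F₀ Fp Fq F₁ G₀ Gp Gq G₁ : Finset (Finset α))
    (hF₀ : IsUpperSet (F₀ : Set (Finset α))) (hFp : IsUpperSet (Fp : Set (Finset α)))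
    (hFq : IsUpperSet (Fq : Set (Finset α))) (hF₁ : IsUpperSet (F₁ : Set (Finset α)))
    (hG₀ : IsUpperSet (G₀ : Set (Finset α))) (hGp : IsUpperSet (Gp : Set (Finset α)))
    (hGq : IsUpperSet (Gq : Set (Finset α))) (hG₁ : IsUpperSet (G₁ : Set (Finset α)))
    (hF0p : F₀ ⊆ Fp) (hF0q : F₀ ⊆ Fq) (hFp1 : Fp ⊆ F₁) (hFq1 : Fq ⊆ F₁) (hG0p : G₀ ⊆ Gp) (hGpq : Gp ⊆ Gq) (hGq1 : Gq ⊆ G₁)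
    (ka kb kc kd ke kf kg kh ki kj : Finset α → ℚ)
    (hka : ∀ s, ka s ≠ 0 → sᶜ ∈ F₀ ∧ s ∈ G₁)
    (hkb : ∀ s, kb s ≠ 0 → s ∈ F₀ ∧ sᶜ ∈ G₁)
    (hkc : ∀ s, kc s ≠ 0 → sᶜ ∈ F₁ ∧ s ∈ G₀)
    (hkd : ∀ s, kd s ≠ 0 → s ∈ F₁ ∧ sᶜ ∈ G₀)
    (hke : ∀ s, ke s ≠ 0 → sᶜ ∈ Fp ∧ s ∈ Gq)
    (hkf : ∀ s, kf s ≠ 0 → s ∈ Fp ∧ sᶜ ∈ Gq)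
    (hkg : ∀ s, kg s ≠ 0 → sᶜ ∈ Fq ∧ s ∈ Gp)
    (hkh : ∀ s, kh s ≠ 0 → s ∈ Fq ∧ sᶜ ∈ Gp)
    (hki : ∀ s, ki s ≠ 0 → (sᶜ ∈ Fq ∧ sᶜ ∉ Fp) ∧ (sᶜ ∈ Gq ∧ sᶜ ∉ Gp))
    (hkj : ∀ s, kj s ≠ 0 → ((sᶜ ∈ F₁ ∧ sᶜ ∉ F₀) ∧ (sᶜ ∈ G₁ ∧ sᶜ ∉ G₀)) ∧ ¬ ((sᶜ ∈ Fp ∧ sᶜ ∉ Fq) ∧ (sᶜ ∈ Gq ∧ sᶜ ∉ Gp)))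
    (h0 : ∀ t, t ∈ F₁ → t ∈ G₁ → zsum ka t + zsum kd t + zsum kf t + zsum kg t + zsum kh t + zsum kj t = 0)
    (h1 : ∀ t, t ∈ F₁ → t ∈ G₁ → zsum kb t + zsum kc t + zsum ke t + zsum kf t + zsum kh t = 0)
    (h2 : ∀ t, t ∈ F₀ → t ∈ G₀ → zsum kd t = 0)
    (h3 : ∀ t, t ∈ F₀ → t ∈ G₀ → zsum kc t = 0)
    (h4 : ∀ t, t ∈ Fp → t ∈ Gp → zsum kc t + zsum kg t = 0)
    (h5 : ∀ t, t ∈ Fp → t ∈ Gp → zsum ke t = 0)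
    (h6 : ∀ t, t ∈ Fq → t ∈ Gq → zsum kb t + zsum kg t = 0)
    (h7 : ∀ t, t ∈ Fq → t ∈ Gq → zsum kc t + zsum kf t + zsum ki t = 0) :
    (∀ s, ka s = 0) ∧ (∀ s, kb s = 0) ∧ (∀ s, kc s = 0) ∧ (∀ s, kd s = 0) ∧ (∀ s, ke s = 0) ∧
      (∀ s, kf s = 0) ∧ (∀ s, kg s = 0) ∧ (∀ s, kh s = 0) ∧ (∀ s, ki s = 0) ∧ (∀ s, kj s = 0) := by
  -- the derived up-sets used as bases / extension targets
  have hS : IsUpperSet ((F₁ ∩ G₁ : Finset (Finset α)) : Set (Finset α)) := by rw [coe_inter]; exact hF₁.inter hG₁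
  have hN : IsUpperSet ((Fq ∩ Gq : Finset (Finset α)) : Set (Finset α)) := by rw [coe_inter]; exact hFq.inter hGq
  have hFB : IsUpperSet ((F₁ ∩ Gp : Finset (Finset α)) : Set (Finset α)) := by rw [coe_inter]; exact hF₁.inter hGp
  have hAG : IsUpperSet ((Fq ∩ G₁ : Finset (Finset α)) : Set (Finset α)) := by rw [coe_inter]; exact hFq.inter hG₁
  have hF0G : IsUpperSet ((F₀ ∩ G₁ : Finset (Finset α)) : Set (Finset α)) := by rw [coe_inter]; exact hF₀.inter hG₁
  have hYs : IsUpperSet ((F₁ ∩ Gp ∪ Fq ∩ G₁ : Finset (Finset α)) : Set (Finset α)) := by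
    rw [coe_union, coe_inter, coe_inter]; exact (hF₁.inter hGp).union (hFq.inter hG₁)
  -- point supports
  have pb : ∀ t, t ∉ F₀ → zsum kb t = 0 := fun t ht => zsum_eq_zero_of_not_mem hF₀ kb (fun d hd => (hkb d hd).1) ht
  have pc : ∀ t, t ∉ G₀ → zsum kc t = 0 := fun t ht => zsum_eq_zero_of_not_mem hG₀ kc (fun d hd => (hkc d hd).2) ht
  have pe : ∀ t, t ∉ Gq → zsum ke t = 0 := fun t ht => zsum_eq_zero_of_not_mem hGq ke (fun d hd => (hke d hd).2) ht
  have pf : ∀ t, t ∉ Fp → zsum kf t = 0 := fun t ht => zsum_eq_zero_of_not_mem hFp kf (fun d hd => (hkf d hd).1) ht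
  have ph : ∀ t, t ∉ Fq → zsum kh t = 0 := fun t ht => zsum_eq_zero_of_not_mem hFq kh (fun d hd => (hkh d hd).1) ht
  -- STEP 1: `g = 0` (C2′ on `Gp ∩ Fq`)
  have hkg0 : ∀ s, kg s = 0 := by
    refine eq_zero_of_zsum_eq_zero_on hGp hFq kg (fun d hd => ⟨(hkg d hd).2, (hkg d hd).1⟩) ?_
    intro t htGp htFq
    by_cases htF₀ : t ∈ F₀
    · have e4 := h4 t (hF0p htF₀) htGp
      by_cases htG₀ : t ∈ G₀
      · rw [h3 t htF₀ htG₀, zero_add] at e4; exact e4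
      · rw [pc t htG₀, zero_add] at e4; exact e4
    · have e6 := h6 t htFq (hGpq htGp)
      rw [pb t htF₀, zero_add] at e6; exact e6
  have zg : ∀ t, zsum kg t = 0 := fun t => by
    unfold zsum; exact Finset.sum_eq_zero fun d _ => by rw [hkg0 d, zero_mul]
  -- consequences: `E6` becomes `Z b = 0` on `N`, `E4` becomes `Z c = 0` on `M`
  have b6 : ∀ t, t ∈ Fq → t ∈ Gq → zsum kb t = 0 := by
    intro t htF htG; have e := h6 t htF htG; rw [zg t, add_zero] at e; exact e
  have c4 : ∀ t, t ∈ Fp → t ∈ Gp → zsum kc t = 0 := by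
    intro t htF htG; have e := h4 t htF htG; rw [zg t, add_zero] at e; exact e
  -- STEP 2: `i = 0` (one diagonal reading of `E1 − E7` on `N`)
  have hki0 : ∀ s, ki s = 0 := by
    have key := diag_read₂ hN hFp hGp ki ke kh (-1) 1 1 (by norm_num) ?_ (fun d hd => (hke d hd).1)
      (fun d hd => (hkh d hd).2) ?_
    · intro s
      by_contra hs
      obtain ⟨⟨-, hnFp⟩, -, hnGp⟩ := hki s hs
      exact hs (key s hnFp hnGp)
    · intro d hd
      obtain ⟨⟨hdFq, -⟩, hdGq, -⟩ := hki d hd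
      exact mem_inter.2 ⟨hdFq, hdGq⟩
    · intro t ht
      have htF := (mem_inter.1 ht).1
      have htG := (mem_inter.1 ht).2
      have e1 := h1 t (hFq1 htF) (hGq1 htG)
      have e7 := h7 t htF htG
      have e6 := b6 t htF htG
      linarith
  have zi : ∀ t, zsum ki t = 0 := fun t => by
    unfold zsum; exact Finset.sum_eq_zero fun d _ => by rw [hki0 d, zero_mul]
  -- `E7` becomes `Z c + Z f = 0` on `N`
  have cf7 : ∀ t, t ∈ Fq → t ∈ Gq → zsum kc t + zsum kf t = 0 := by
    intro t htF htG; have e := h7 t htF htG; rw [zi t, add_zero] at e; exact e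
  -- STEP 3: `c = 0`
  -- (3a) `Z e = 0` on `F₁ ∩ Gp`: antipodal extension from `M = Fp ∩ Gp` (complements of `e`-indices lie in `Fp`)
  have eFB : ∀ t, t ∈ F₁ ∩ Gp → zsum ke t = 0 := by
    refine zsum_ext hFp hFB ke (fun d hd => (hke d hd).1) ?_
    intro t htFp ht
    exact h5 t htFp (mem_inter.1 ht).2
  -- (3b) `Z c = 0` on `G₀ ∩ F₁`, then C2′
  have hkc0 : ∀ s, kc s = 0 := by
    refine eq_zero_of_zsum_eq_zero_on hG₀ hF₁ kc (fun d hd => ⟨(hkc d hd).2, (hkc d hd).1⟩) ?_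
    intro t htG₀ htF₁
    by_cases htFp : t ∈ Fp
    · exact c4 t htFp (hG0p htG₀)
    · by_cases htFq : t ∈ Fq
      · have e := cf7 t htFq (hGpq (hG0p htG₀))
        rw [pf t htFp, add_zero] at e; exact e
      · have htF₀ : t ∉ F₀ := fun h => htFp (hF0p h)
        have e1 := h1 t htF₁ (hGq1 (hGpq (hG0p htG₀)))
        rw [pb t htF₀, pf t htFp, ph t htFq, eFB t (mem_inter.2 ⟨htF₁, hG0p htG₀⟩)] at e1
        linarith
  have zc : ∀ t, zsum kc t = 0 := fun t => by
    unfold zsum; exact Finset.sum_eq_zero fun d _ => by rw [hkc0 d, zero_mul]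
  -- `E7` becomes `Z f = 0` on `N`
  have f7 : ∀ t, t ∈ Fq → t ∈ Gq → zsum kf t = 0 := by
    intro t htF htG; have e := cf7 t htF htG; rw [zc t, zero_add] at e; exact e
  -- STEP 4: `h = 0` (C2′ on `Fq ∩ Gp`, reading `E1`)
  have hkh0 : ∀ s, kh s = 0 := by
    refine eq_zero_of_zsum_eq_zero_on hFq hGp kh hkh ?_
    intro t htFq htGp
    have htGq := hGpq htGp
    have e1 := h1 t (hFq1 htFq) (hGq1 htGq)
    rw [b6 t htFq htGq, zc t, eFB t (mem_inter.2 ⟨hFq1 htFq, htGp⟩), f7 t htFq htGq] at e1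
    linarith
  have zh : ∀ t, zsum kh t = 0 := fun t => by
    unfold zsum; exact Finset.sum_eq_zero fun d _ => by rw [hkh0 d, zero_mul]
  -- STEP 5: `b = 0`
  -- (5a) `Z f = 0` on `Fq ∩ G₁`: antipodal extension from `N` (complements of `f`-indices lie in `Gq`)
  have fAG : ∀ t, t ∈ Fq ∩ G₁ → zsum kf t = 0 := by
    refine zsum_ext hGq hAG kf (fun d hd => (hkf d hd).2) ?_
    intro t htGq ht
    exact f7 t (mem_inter.1 ht).1 htGq
  -- (5b) `Z b = 0` on `F₀ ∩ G₁` (`E6` inside `Gq`, `E1` outside), then C2′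
  have hkb0 : ∀ s, kb s = 0 := by
    refine eq_zero_of_zsum_eq_zero_on hF₀ hG₁ kb hkb ?_
    intro t htF₀ htG₁
    by_cases htGq : t ∈ Gq
    · exact b6 t (hF0q htF₀) htGq
    · have e1 := h1 t (hFp1 (hF0p htF₀)) htG₁
      rw [zc t, pe t htGq, fAG t (mem_inter.2 ⟨hF0q htF₀, htG₁⟩), zh t] at e1
      linarith
  have zb : ∀ t, zsum kb t = 0 := fun t => by
    unfold zsum; exact Finset.sum_eq_zero fun d _ => by rw [hkb0 d, zero_mul]
  -- `E1` becomes `Z e + Z f = 0` on `S`; (6a) `Z e = 0` on `Fq ∩ G₁`; `E0` becomes `Z a + Z d + Z f + Z j = 0` on `S`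
  have ef1 : ∀ t, t ∈ F₁ → t ∈ G₁ → zsum ke t + zsum kf t = 0 := by
    intro t htF htG; have e := h1 t htF htG; rw [zb t, zc t, zh t] at e; linarith
  have eAG : ∀ t, t ∈ Fq ∩ G₁ → zsum ke t = 0 := by
    intro t ht
    have e := ef1 t (hFq1 (mem_inter.1 ht).1) (mem_inter.1 ht).2
    rw [fAG t ht, add_zero] at e; exact e
  have adfj : ∀ t, t ∈ F₁ → t ∈ G₁ → zsum ka t + zsum kd t + zsum kf t + zsum kj t = 0 := by
    intro t htF htG; have e := h0 t htF htG; rw [zg t, zh t] at e; linarith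
  -- STEP 6: `j = 0` in three diagonal readings
  -- (6b) `E0` on `S`: the foreign classes `a, d, f` have coordinates on `refl F₀ ∪ refl G₀ ∪ refl Gq`
  have j1 : ∀ u, uᶜ ∉ F₀ → uᶜ ∉ G₀ → uᶜ ∉ Gq → kj u = 0 := by
    refine diag_read₃ hS hF₀ hG₀ hGq kj ka kd kf 1 1 1 1 one_ne_zero ?_ (fun d hd => (hka d hd).1) (fun d hd => (hkd d hd).2)
      (fun d hd => (hkf d hd).2) ?_
    · intro d hd
      obtain ⟨⟨⟨x1, -⟩, x3, -⟩, -⟩ := hkj d hd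
      exact mem_inter.2 ⟨x1, x3⟩
    · intro t ht
      have e := adfj t (mem_inter.1 ht).1 (mem_inter.1 ht).2
      linarith
  -- (6c) `E0 − E1` on `S`: the foreign classes `a, d, e` have coordinates on `refl F₀ ∪ refl G₀ ∪ refl Fp`
  have j2 : ∀ u, uᶜ ∉ F₀ → uᶜ ∉ G₀ → uᶜ ∉ Fp → kj u = 0 := by
    refine diag_read₃ hS hF₀ hG₀ hFp kj ka kd ke 1 1 1 (-1) one_ne_zero ?_ (fun d hd => (hka d hd).1) (fun d hd => (hkd d hd).2)
      (fun d hd => (hke d hd).1) ?_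
    · intro d hd
      obtain ⟨⟨⟨x1, -⟩, x3, -⟩, -⟩ := hkj d hd
      exact mem_inter.2 ⟨x1, x3⟩
    · intro t ht
      have e := adfj t (mem_inter.1 ht).1 (mem_inter.1 ht).2
      have e' := ef1 t (mem_inter.1 ht).1 (mem_inter.1 ht).2
      linarith
  -- (6d) on `Y* = F₁Gp ∪ FqG₁` (where `Z e = 0`) the surviving `j`-indices are diagonal: `E0 − E1 = Z j + Z a + Z d` kills them
  have hkj0 : ∀ s, kj s = 0 := by
    have key := diag_read₂ hYs hF₀ hG₀ kj ka kd 1 1 1 one_ne_zero ?_ (fun d hd => (hka d hd).1) (fun d hd => (hkd d hd).2) ?_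
    · intro s
      by_contra hs
      obtain ⟨⟨⟨-, x2⟩, -, x4⟩, -⟩ := hkj s hs
      exact hs (key s x2 x4)
    · intro d hd
      obtain ⟨⟨⟨x1, x2⟩, x3, x4⟩, hno⟩ := hkj d hd
      have dGq : dᶜ ∈ Gq := by
        by_contra h'
        exact hd (j1 d x2 x4 h')
      have dFp : dᶜ ∈ Fp := by
        by_contra h'
        exact hd (j2 d x2 x4 h')
      rw [mem_union]
      by_cases dFq : dᶜ ∈ Fq
      · exact Or.inr (mem_inter.2 ⟨dFq, x3⟩)
      · by_cases dGp : dᶜ ∈ Gp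
        · exact Or.inl (mem_inter.2 ⟨x1, dGp⟩)
        · exact absurd ⟨⟨dFp, dFq⟩, dGq, dGp⟩ hno
    · intro t ht
      rcases mem_union.1 ht with h' | h'
      · have htF := (mem_inter.1 h').1
        have htG : t ∈ G₁ := hGq1 (hGpq (mem_inter.1 h').2)
        have e := adfj t htF htG
        have e' := ef1 t htF htG
        have e'' := eFB t h'
        linarith
      · have htF : t ∈ F₁ := hFq1 (mem_inter.1 h').1
        have htG := (mem_inter.1 h').2
        have e := adfj t htF htG
        have e' := ef1 t htF htG
        have e'' := eAG t h'
        linarith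
  have zj : ∀ t, zsum kj t = 0 := fun t => by
    unfold zsum; exact Finset.sum_eq_zero fun d _ => by rw [hkj0 d, zero_mul]
  -- STEP 7: `a`, `d`, `f`, `e`
  -- (7a) `Z d = 0` on `F₀ ∩ G₁`: antipodal extension from `U` (complements of `d`-indices lie in `G₀`)
  have dF0G : ∀ t, t ∈ F₀ ∩ G₁ → zsum kd t = 0 := by
    refine zsum_ext hG₀ hF0G kd (fun d hd => (hkd d hd).2) ?_
    intro t htG₀ ht
    exact h2 t (mem_inter.1 ht).1 htG₀
  -- (7b) `E0 − E1` on `F₀ ∩ G₁` kills `a` (C2′)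
  have hka0 : ∀ s, ka s = 0 := by
    refine eq_zero_of_zsum_eq_zero_on hG₁ hF₀ ka (fun d hd => ⟨(hka d hd).2, (hka d hd).1⟩) ?_
    intro t htG₁ htF₀
    have htF₁ : t ∈ F₁ := hFp1 (hF0p htF₀)
    have e := adfj t htF₁ htG₁
    have e' := ef1 t htF₁ htG₁
    have e1 := dF0G t (mem_inter.2 ⟨htF₀, htG₁⟩)
    have e2 := eAG t (mem_inter.2 ⟨hF0q htF₀, htG₁⟩)
    have e3 := zj t
    linarith
  have za : ∀ t, zsum ka t = 0 := fun t => by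
    unfold zsum; exact Finset.sum_eq_zero fun d _ => by rw [hka0 d, zero_mul]
  -- (7c) `E0 − E1` on `F₁ ∩ G₀` kills `d` (C2′)
  have hkd0 : ∀ s, kd s = 0 := by
    refine eq_zero_of_zsum_eq_zero_on hF₁ hG₀ kd hkd ?_
    intro t htF₁ htG₀
    have htG₁ : t ∈ G₁ := hGq1 (hGpq (hG0p htG₀))
    have e := adfj t htF₁ htG₁
    have e' := ef1 t htF₁ htG₁
    have e1 := eFB t (mem_inter.2 ⟨htF₁, hG0p htG₀⟩)
    have e2 := za t
    have e3 := zj t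
    linarith
  have zd : ∀ t, zsum kd t = 0 := fun t => by
    unfold zsum; exact Finset.sum_eq_zero fun d _ => by rw [hkd0 d, zero_mul]
  -- (7d) `E0` kills `f`, then `E1` kills `e` (C2′)
  have hkf0 : ∀ s, kf s = 0 := by
    refine eq_zero_of_zsum_eq_zero_on hFp hGq kf hkf ?_
    intro t htFp htGq
    have e := adfj t (hFp1 htFp) (hGq1 htGq)
    rw [za t, zd t, zj t] at e
    linarith
  have zf : ∀ t, zsum kf t = 0 := fun t => by
    unfold zsum; exact Finset.sum_eq_zero fun d _ => by rw [hkf0 d, zero_mul]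
  have hke0 : ∀ s, ke s = 0 := by
    refine eq_zero_of_zsum_eq_zero_on hGq hFp ke (fun d hd => ⟨(hke d hd).2, (hke d hd).1⟩) ?_
    intro t htGq htFp
    have e := ef1 t (hFp1 htFp) (hGq1 htGq)
    rw [zf t, add_zero] at e
    exact e
  exact ⟨hka0, hkb0, hkc0, hkd0, hke0, hkf0, hkg0, hkh0, hki0, hkj0⟩

/-! ### Restriction to an up-set `P` -/

/-- **Half-chain Hall, kernel form inside an up-set `P`** (the restriction to `P` is free: a demand `s ∈ P` only sees supplies `t ⊇ s`, which lie in
`P`).  Supports literally the ten summands of `halfChainDemand P F₀ Fp Fq F₁ G₀ Gp Gq G₁`, equations on the eight supply blocks of `halfChainSupply`. [this work] -/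
theorem halfChain_kernel_eq_zero_of_upperSet (P F₀ Fp Fq F₁ G₀ Gp Gq G₁ : Finset (Finset α))
    (hP : IsUpperSet (P : Set (Finset α)))
    (hF₀ : IsUpperSet (F₀ : Set (Finset α))) (hFp : IsUpperSet (Fp : Set (Finset α)))
    (hFq : IsUpperSet (Fq : Set (Finset α))) (hF₁ : IsUpperSet (F₁ : Set (Finset α)))
    (hG₀ : IsUpperSet (G₀ : Set (Finset α))) (hGp : IsUpperSet (Gp : Set (Finset α)))
    (hGq : IsUpperSet (Gq : Set (Finset α))) (hG₁ : IsUpperSet (G₁ : Set (Finset α)))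
    (hF0p : F₀ ⊆ Fp) (hF0q : F₀ ⊆ Fq) (hFp1 : Fp ⊆ F₁) (hFq1 : Fq ⊆ F₁) (hG0p : G₀ ⊆ Gp) (hGpq : Gp ⊆ Gq) (hGq1 : Gq ⊆ G₁)
    (ka kb kc kd ke kf kg kh ki kj : Finset α → ℚ)
    (hka : ∀ s, ka s ≠ 0 → s ∈ P ∧ sᶜ ∈ F₀ ∧ s ∈ G₁)
    (hkb : ∀ s, kb s ≠ 0 → s ∈ P ∧ s ∈ F₀ ∧ sᶜ ∈ G₁)
    (hkc : ∀ s, kc s ≠ 0 → s ∈ P ∧ sᶜ ∈ F₁ ∧ s ∈ G₀)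
    (hkd : ∀ s, kd s ≠ 0 → s ∈ P ∧ s ∈ F₁ ∧ sᶜ ∈ G₀)
    (hke : ∀ s, ke s ≠ 0 → s ∈ P ∧ sᶜ ∈ Fp ∧ s ∈ Gq)
    (hkf : ∀ s, kf s ≠ 0 → s ∈ P ∧ s ∈ Fp ∧ sᶜ ∈ Gq)
    (hkg : ∀ s, kg s ≠ 0 → s ∈ P ∧ sᶜ ∈ Fq ∧ s ∈ Gp)
    (hkh : ∀ s, kh s ≠ 0 → s ∈ P ∧ s ∈ Fq ∧ sᶜ ∈ Gp)
    (hki : ∀ s, ki s ≠ 0 → s ∈ P ∧ sᶜ ∈ (Fq \ Fp) ∩ (Gq \ Gp))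
    (hkj : ∀ s, kj s ≠ 0 → s ∈ P ∧ sᶜ ∈ ((F₁ \ F₀) ∩ (G₁ \ G₀)) \ ((Fp \ Fq) ∩ (Gq \ Gp)))
    (h0 : ∀ t, t ∈ P → t ∈ F₁ → t ∈ G₁ → zsum ka t + zsum kd t + zsum kf t + zsum kg t + zsum kh t + zsum kj t = 0)
    (h1 : ∀ t, t ∈ P → t ∈ F₁ → t ∈ G₁ → zsum kb t + zsum kc t + zsum ke t + zsum kf t + zsum kh t = 0)
    (h2 : ∀ t, t ∈ P → t ∈ F₀ → t ∈ G₀ → zsum kd t = 0)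
    (h3 : ∀ t, t ∈ P → t ∈ F₀ → t ∈ G₀ → zsum kc t = 0)
    (h4 : ∀ t, t ∈ P → t ∈ Fp → t ∈ Gp → zsum kc t + zsum kg t = 0)
    (h5 : ∀ t, t ∈ P → t ∈ Fp → t ∈ Gp → zsum ke t = 0)
    (h6 : ∀ t, t ∈ P → t ∈ Fq → t ∈ Gq → zsum kb t + zsum kg t = 0)
    (h7 : ∀ t, t ∈ P → t ∈ Fq → t ∈ Gq → zsum kc t + zsum kf t + zsum ki t = 0) :
    (∀ s, ka s = 0) ∧ (∀ s, kb s = 0) ∧ (∀ s, kc s = 0) ∧ (∀ s, kd s = 0) ∧ (∀ s, ke s = 0) ∧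
      (∀ s, kf s = 0) ∧ (∀ s, kg s = 0) ∧ (∀ s, kh s = 0) ∧ (∀ s, ki s = 0) ∧ (∀ s, kj s = 0) := by
  -- off `P` every combination vanishes (point support in `P`)
  have va : ∀ t, t ∉ P → zsum ka t = 0 := fun t ht => zsum_eq_zero_of_not_mem hP ka (fun d hd => (hka d hd).1) ht
  have vb : ∀ t, t ∉ P → zsum kb t = 0 := fun t ht => zsum_eq_zero_of_not_mem hP kb (fun d hd => (hkb d hd).1) ht
  have vc : ∀ t, t ∉ P → zsum kc t = 0 := fun t ht => zsum_eq_zero_of_not_mem hP kc (fun d hd => (hkc d hd).1) ht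
  have vd : ∀ t, t ∉ P → zsum kd t = 0 := fun t ht => zsum_eq_zero_of_not_mem hP kd (fun d hd => (hkd d hd).1) ht
  have ve : ∀ t, t ∉ P → zsum ke t = 0 := fun t ht => zsum_eq_zero_of_not_mem hP ke (fun d hd => (hke d hd).1) ht
  have vf : ∀ t, t ∉ P → zsum kf t = 0 := fun t ht => zsum_eq_zero_of_not_mem hP kf (fun d hd => (hkf d hd).1) ht
  have vg : ∀ t, t ∉ P → zsum kg t = 0 := fun t ht => zsum_eq_zero_of_not_mem hP kg (fun d hd => (hkg d hd).1) ht
  have vh : ∀ t, t ∉ P → zsum kh t = 0 := fun t ht => zsum_eq_zero_of_not_mem hP kh (fun d hd => (hkh d hd).1) ht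
  have vi : ∀ t, t ∉ P → zsum ki t = 0 := fun t ht => zsum_eq_zero_of_not_mem hP ki (fun d hd => (hki d hd).1) ht
  have vj : ∀ t, t ∉ P → zsum kj t = 0 := fun t ht => zsum_eq_zero_of_not_mem hP kj (fun d hd => (hkj d hd).1) ht
  refine halfChain_kernel_eq_zero F₀ Fp Fq F₁ G₀ Gp Gq G₁ hF₀ hFp hFq hF₁ hG₀ hGp hGq hG₁ hF0p hF0q hFp1 hFq1 hG0p hGpq hGq1
    ka kb kc kd ke kf kg kh ki kj (fun s hs => (hka s hs).2) (fun s hs => (hkb s hs).2) (fun s hs => (hkc s hs).2)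
    (fun s hs => (hkd s hs).2) (fun s hs => (hke s hs).2) (fun s hs => (hkf s hs).2) (fun s hs => (hkg s hs).2)
    (fun s hs => (hkh s hs).2) ?_ ?_ ?_ ?_ ?_ ?_ ?_ ?_ ?_ ?_
  · intro s hs
    have h' := (hki s hs).2
    rw [mem_inter, mem_sdiff, mem_sdiff] at h'
    exact h'
  · intro s hs
    have h' := (hkj s hs).2
    rw [mem_sdiff, mem_inter, mem_sdiff, mem_sdiff, mem_inter, mem_sdiff, mem_sdiff] at h'
    exact h'
  · intro t htF htG
    by_cases htP : t ∈ P
    · exact h0 t htP htF htG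
    · rw [va t htP, vd t htP, vf t htP, vg t htP, vh t htP, vj t htP]; ring
  · intro t htF htG
    by_cases htP : t ∈ P
    · exact h1 t htP htF htG
    · rw [vb t htP, vc t htP, ve t htP, vf t htP, vh t htP]; ring
  · intro t htF htG
    by_cases htP : t ∈ P
    · exact h2 t htP htF htG
    · exact vd t htP
  · intro t htF htG
    by_cases htP : t ∈ P
    · exact h3 t htP htF htG
    · exact vc t htP
  · intro t htF htG
    by_cases htP : t ∈ P
    · exact h4 t htP htF htG
    · rw [vc t htP, vg t htP]; ring
  · intro t htF htG
    by_cases htP : t ∈ P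
    · exact h5 t htP htF htG
    · exact ve t htP
  · intro t htF htG
    by_cases htP : t ∈ P
    · exact h6 t htP htF htG
    · rw [vb t htP, vg t htP]; ring
  · intro t htF htG
    by_cases htP : t ∈ P
    · exact h7 t htP htF htG
    · rw [vc t htP, vf t htP, vi t htP]; ring

end FiveUpSet

end Summit.CriticalPhenomena.PercolationContinuityZ3.Theorems
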